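import Summits.CriticalPhenomena.PercolationContinuityZ3.Theorems.PercNearOneGluingNoHeavyQuantGatedSliceMixLawQKCellsA
import Summits.CriticalPhenomena.PercolationContinuityZ3.Theorems.PercNearOneGluingNoHeavyQuantGatedSliceMixLawQKCellsB
import Summits.CriticalPhenomena.PercolationContinuityZ3.Theorems.PercNearOneGluingNoHeavyQuantGatedSliceMixLawQKIneqLH
import Summits.CriticalPhenomena.PercolationContinuityZ3.Theorems.PercNearOneGluingNoHeavyQuantGatedSliceMixLawCellsEasy
import Summits.CriticalPhenomena.PercolationContinuityZ3.Theorems.PercNearOneGluingNoHeavyQuantGatedSliceMixLawQTwinGiant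
import HarnessLib

/-!
# QUANT lane R8, T-DEC, leg (III), blob case — `LawDec.GatedSliceMixLaw'`, Q-ALONE side: cell QK (the top `k₂` a `t`-low), part C —
# the last sub-case (top light, low heavy at the twin) and the assembly: **`MixLawCellQK` HOLDS**

builds on p205010 (kernel theorem, internal audit signed; external expert review pending)

Support file (`--supports stmt-CriticalPhenomena-4575`), QUANT lane seat prim-quant-arm-1 (gen 41), rung R8 of `run/shared/lean/prim/quant/LADDER.md`.
Theorems only, standard axioms, no sorries, no definitions.  Parts A/B: `…QKCellsA` (`…qk_topSat`, `…qk_topFits`), `…QKCellsB`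
(`…qk_twinHigh_of_Ib/_heavyTop/_lightBoth`); the scalar lemma of the remaining sub-case is `qk_Ib_lh` (`…QKIneqLH`).
* **`mixLawQ_decAtT_qk_twinHigh_lightTop_heavyLow`** — class `LM`, the top light and the low `k₁` heavy at the twin.
* **`mixLawQ_decAtT_cellQK`** — the whole cell: `k₁ ≤ j` with `2k₁ < t` (or `k₁ = 0`), twin `k₁ + a ≤ j` a mid, top `k₂ ≤ j` a `t`-low,
  `k₂ + a ≥ j+1` ⟹ `Q` is DEC (case tree: top saturates / top fits and [`k₁ = 0` or twin ≤ `t`] / twin above `t` by rate regime).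
* **`mixLawCellQK_holds : MixLawCellQK`** — typer g30's binder (`…QuantGatedSliceMixLawCells`): with `k₂ + a ≤ j` by cell Q1
  (`mixLawCellQ1_holds`), with the twin a giant by `mixLawQ_decAtT_of_twinGiant`, otherwise `mixLawQ_decAtT_cellQK`.
EXACT CENSUS (`work/explore/qQH.py`, `qQK*.py`): 85 342 instances of the binder / 0 non-DEC; every branch of the case tree is populated.
HONEST STATUS: cells Q4/QH assemblies next; `GatedSliceMixLaw'` (regime R), CW, `GateMove`, `GatedConvEmptyFree`, `SingleGateConvClosed`,
`TreeDEC`, `FarTreeRow` OPEN; RATE class log\* / honest sentence unchanged.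

[this work]; binder: prim-quant-typer g30; node: prim-quant-stmt g29/g30 (this lane).  Nothing here is cited as a published result.
The gluing rows served [cite: KozmaNitzan2024, Conjecture 3 (p. 15)]; product measure [cite: Grimmett1999, §1.3 p. 10].
-/

noncomputable section

namespace Summit.CriticalPhenomena.PercolationContinuityZ3.Theorems

namespace Quant

open Finset

/-- the two-point law `{lo, hi; g}` (as in `…QuantLawDEC`) -/
local notation3 "TP[" lo ", " hi ", " g ", " h "]" =>
  (g : ℝ) * (if (h : ℕ) = (hi : ℕ) then (1 : ℝ) else 0) + (1 - (g : ℝ)) * (if (h : ℕ) = (lo : ℕ) then (1 : ℝ) else 0)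

namespace LawDec

set_option maxHeartbeats 1600000 in
/-- **CELL QK, CLASS `LM`, THE TOP LIGHT AND THE LOW HEAVY AT THE TWIN ⟹ `Q` IS DEC.**  (Ib) from `qk_Ib_lh`. [this work] -/
theorem mixLawQ_decAtT_qk_twinHigh_lightTop_heavyLow (y z g S lam : ℝ) (a j M k₁ k₂ : ℕ)
    (hy0 : 0 < y) (hy1 : y < 1) (hz0 : 0 ≤ z) (hz1 : z < 1) (hg1 : g ≤ 1) (hyg : y ≤ (1 - z) * g) (ha : 1 ≤ a)
    (hta : y * (M : ℝ) ≤ S) (hk : k₁ ≤ k₂) (hk₂M : k₂ ≤ M) (hlam0 : 0 ≤ lam) (hlam1 : lam ≤ 1)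
    (hmean : (1 - z) * ((k₁ : ℝ) + ((k₂ : ℝ) - k₁) * lam) = S)
    (hk₁ : 1 ≤ k₁) (hk₁j : k₁ ≤ j) (hk₁low : 2 * (k₁ : ℝ) < S + (a : ℝ) * g * (1 - z))
    (hPj : k₁ + a ≤ j) (hPmid : S + (a : ℝ) * g * (1 - z) ≤ 2 * ((k₁ + a : ℕ) : ℝ)) (hPt : S + (a : ℝ) * g * (1 - z) < (k₁ : ℝ) + a)
    (hKj : k₂ ≤ j) (hKlow : 2 * (k₂ : ℝ) < S + (a : ℝ) * g * (1 - z)) (hG : j + 1 ≤ k₂ + a)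
    (hfit : usage y (S + (a : ℝ) * g * (1 - z)) j k₂ (k₁ + a) * ((1 - z) * lam * (1 - g)) ≤ (1 - z) * (1 - lam) * g)
    (hlightK : S + (a : ℝ) * g * (1 - z) - 2 * (k₂ : ℝ) < y * (((k₁ : ℝ) + a) - k₂))
    (hheavyk : y * (a : ℝ) ≤ S + (a : ℝ) * g * (1 - z) - 2 * (k₁ : ℝ)) :
    DECAtT y (S + (a : ℝ) * g * (1 - z)) j (M + a)
      (fun p => z * (if p = 0 then (1 : ℝ) else 0) + (1 - z) * slice (fun q => TP[k₁, k₂, lam, q]) a g p) := by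
  set t : ℝ := S + (a : ℝ) * g * (1 - z) with ht
  set A : ℝ := (1 - z) * (1 - lam) * (1 - g) with hA
  set B : ℝ := (1 - z) * (1 - lam) * g with hB
  set C : ℝ := (1 - z) * lam * (1 - g) with hC
  set D : ℝ := (1 - z) * lam * g with hD
  have hg0 : 0 < g := by
    by_contra hc
    have : (1 - z) * g ≤ 0 := mul_nonpos_of_nonneg_of_nonpos (by linarith) (not_lt.1 hc)
    linarith
  have h1z : 0 < 1 - z := by linarith
  have h1y : 0 < 1 - y := by linarith
  have hC0 : 0 ≤ C := mul_nonneg (mul_nonneg h1z.le hlam0) (by linarith)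
  have hkr : (k₁ : ℝ) ≤ k₂ := by exact_mod_cast hk
  have hk₁r : (1 : ℝ) ≤ k₁ := by exact_mod_cast hk₁
  have hPr : ((k₁ + a : ℕ) : ℝ) = (k₁ : ℝ) + a := by push_cast; ring
  have hPng : ¬ (j + 1 ≤ k₁ + a) := by omega
  have hPcomp : t < (k₁ : ℝ) + ((k₁ + a : ℕ) : ℝ) := by rw [hPr]; linarith
  -- the pair (K, P), light
  set W₂ : ℝ := t - 2 * (k₂ : ℝ) with hW₂
  set d₂ : ℝ := ((k₁ + a : ℕ) : ℝ) - (k₂ : ℝ) with hd₂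
  set p : ℝ := ((k₁ + a : ℕ) : ℝ) - t with hp
  have hW₂0 : 0 < W₂ := by rw [hW₂]; linarith
  have hp0 : 0 < p := by rw [hp, hPr]; linarith
  have hd₂0 : 0 < d₂ := by rw [hd₂]; linarith
  have hpK : 0 < p + (k₁ : ℝ) := by linarith
  set ρ₂ : ℝ := W₂ / d₂ with hρ₂
  have hρ0 : 0 < ρ₂ := div_pos hW₂0 hd₂0
  have hρy : ρ₂ < y := by rw [hρ₂, div_lt_iff₀ hd₂0, hd₂, hPr]; exact hlightK
  set γ : ℝ := y ^ 2 + (1 - y) * ρ₂ with hγ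
  have hγ0 : 0 < γ := by
    have h1 : 0 < (1 - y) * ρ₂ := mul_pos h1y hρ0
    rw [hγ]; linarith [sq_nonneg y]
  have hγy : γ ≤ y := by
    have h1 := mul_le_mul_of_nonneg_left hρy.le h1y.le
    rw [hγ]; linarith [h1, show y ^ 2 + (1 - y) * y = y by ring]
  have hγ1 : γ < 1 := by linarith
  have huK : usage y t j k₂ (k₁ + a) = γ / (1 - γ) := by
    have hmax : ρ₂ ≤ y ^ 2 + (1 - y) * ρ₂ := by
      have h1 := mul_le_mul_of_nonneg_left hρy.le hy0.le
      linarith [h1, show y ^ 2 = y * y by ring, show (1 - y) * ρ₂ = ρ₂ - y * ρ₂ by ring]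
    simp only [usage, gateOf, if_neg hPng, pairGate]
    rw [← hW₂, ← hd₂, ← hρ₂, max_eq_right hmax]
  -- `γ·d₂ = y²d₂ + (1−y)W₂`, `(1−γ)d₂ = d₂ − y²d₂ − (1−y)W₂`
  have hγd : γ * d₂ = y * y * d₂ + (1 - y) * W₂ := by
    rw [hγ, hρ₂]; field_simp
  have h1γd : (1 - γ) * d₂ = d₂ - y * y * d₂ - (1 - y) * W₂ := by
    linarith [hγd, show (1 - γ) * d₂ = d₂ - γ * d₂ by ring]
  -- the pair (k₁, P), heavy: `usage = W₁/(p + k₁)`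
  set W₁ : ℝ := t - 2 * (k₁ : ℝ) with hW₁
  have hW₁0 : 0 < W₁ := by rw [hW₁]; linarith
  have ha1 : (1 : ℝ) ≤ a := by exact_mod_cast ha
  have ha0 : (0 : ℝ) < a := by linarith
  have hd₁ : ((k₁ + a : ℕ) : ℝ) - (k₁ : ℝ) = a := by rw [hPr]; ring
  set ρ₁ : ℝ := W₁ / a with hρ₁
  have hyρ : y ≤ ρ₁ := by rw [hρ₁, le_div_iff₀ ha0]; exact hheavyk
  have haW : a - W₁ = p + k₁ := by rw [hW₁, hp, hPr]; ring
  have huP : usage y t j k₁ (k₁ + a) = ρ₁ / (1 - ρ₁) := by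
    have hmax : y ^ 2 + (1 - y) * ρ₁ ≤ ρ₁ := by
      have h := mul_nonpos_of_nonneg_of_nonpos hy0.le (sub_nonpos.2 hyρ)
      linarith [h, show y ^ 2 + (1 - y) * ρ₁ = ρ₁ + y * (y - ρ₁) by ring]
    simp only [usage, gateOf, if_neg hPng, pairGate]
    rw [hd₁, ← hW₁, ← hρ₁, max_eq_left hmax]
  have hU₁W : usage y t j k₁ (k₁ + a) * (p + k₁) = W₁ := by
    rw [huP, hρ₁, ← haW]
    have hane : (a : ℝ) ≠ 0 := ne_of_gt ha0
    have haWne : (a : ℝ) - W₁ ≠ 0 := by rw [haW]; exact ne_of_gt hpK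
    field_simp
  refine mixLawQ_decAtT_qk_twinHigh_of_Ib y z g S lam a j M k₁ k₂ hy0 hy1 hz0 hz1 hg1 hyg ha hta hk hk₂M hlam0 hlam1 hmean hk₁ hk₁j
    hk₁low hPj hPmid hPt hKj hKlow hG hfit ?_
  set X : ℝ := y * (z + A) - (1 - y) * D with hXdef
  have hfit' : 0 ≤ B - usage y t j k₂ (k₁ + a) * C := by linarith
  have hU₁0 : 0 ≤ usage y t j k₁ (k₁ + a) := by
    by_contra hc
    have : usage y t j k₁ (k₁ + a) * (p + k₁) ≤ 0 := mul_nonpos_of_nonpos_of_nonneg (not_le.1 hc).le hpK.le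
    linarith [hU₁W, hW₁0]
  by_cases hXle : X ≤ 0
  · have h1 : usage y t j k₁ (k₁ + a) * X ≤ 0 := mul_nonpos_of_nonneg_of_nonpos hU₁0 hXle
    linarith [h1, mul_nonneg hy0.le hfit']
  · have hXpos : 0 < X := not_le.1 hXle
    have hEX : y * (1 - (1 - z) * (1 - lam) * g - (1 - z) * lam * (1 - g)) - (1 - z) * lam * g = X := by rw [hXdef, hA, hD]; ring
    -- top-affordability of `K`, `k₂ + 1 ≤ a`
    have hyK : y * (k₂ : ℝ) ≤ S := (mul_le_mul_of_nonneg_left (by exact_mod_cast hk₂M) hy0.le).trans hta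
    have hKa : (k₂ : ℝ) + 1 ≤ a := by
      have h1 : 2 * (k₂ : ℝ) < 2 * ((k₁ + a : ℕ) : ℝ) := lt_of_lt_of_le hKlow hPmid
      -- `k₂ < k₁ + a` is not enough; use `t ≤ k₂ + a`: `S ≤ k₂`, `ag(1−z) ≤ a`
      have hS : S ≤ (k₂ : ℝ) := by
        rw [← hmean]
        have hd0 : 0 ≤ (k₂ : ℝ) - k₁ := by linarith
        have h3 : ((k₂ : ℝ) - k₁) * lam ≤ (k₂ : ℝ) - k₁ := mul_le_of_le_one_right hd0 hlam1
        have h0 : 0 ≤ (k₁ : ℝ) + ((k₂ : ℝ) - k₁) * lam := by nlinarith [mul_nonneg hd0 hlam0]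
        calc (1 - z) * ((k₁ : ℝ) + ((k₂ : ℝ) - k₁) * lam) ≤ 1 * ((k₁ : ℝ) + ((k₂ : ℝ) - k₁) * lam) :=
              mul_le_mul_of_nonneg_right (by linarith) h0
          _ ≤ k₂ := by linarith
      have hagz : (a : ℝ) * g * (1 - z) ≤ a := by
        have h5 : g * (1 - z) ≤ 1 := by
          calc g * (1 - z) ≤ g * 1 := mul_le_mul_of_nonneg_left (by linarith) hg0.le
            _ ≤ 1 := by linarith
        have h6 := mul_le_mul_of_nonneg_left h5 (Nat.cast_nonneg a)
        linarith [h6, show (a : ℝ) * g * (1 - z) = (a : ℝ) * (g * (1 - z)) by ring]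
      have h2 : (k₂ : ℝ) < a := by linarith
      have h3 : k₂ < a := by exact_mod_cast h2
      exact_mod_cast (show k₂ + 1 ≤ a by omega)
    -- `k₁ < k₂`: a low cannot be both heavy and light at the same high point
    have hklt : (k₁ : ℝ) + 1 ≤ k₂ := by
      have hne : k₁ ≠ k₂ := by
        intro heq
        have e : y * (((k₁ : ℝ) + a) - k₂) = y * a := by rw [← heq]; ring
        have e2 : (2 : ℝ) * (k₂ : ℝ) = 2 * (k₁ : ℝ) := by rw [heq]
        linarith [hlightK, hheavyk, e, e2]
      exact_mod_cast (show k₁ + 1 ≤ k₂ by omega)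
    have hL := qk_Ib_lh y z g lam S (k₁ : ℝ) (k₂ : ℝ) (a : ℝ) hy0 hy1 hz0 hz1 hg0.le hg1 hlam0 hlam1 hyg hk₁r hklt hKa hmean hyK
      hPt hW₂0 hlightK hheavyk (by rw [hEX]; exact hXpos.le)
    rw [hEX] at hL
    -- `hL : W₁·X·((1−γ)d₂) ≤ y(p+k₁)(B(1−γ)d₂ − γd₂·C)`
    have hd₂' : (k₁ : ℝ) + a - k₂ = d₂ := by rw [hd₂, hPr]
    have hp' : (k₁ : ℝ) + a - (S + (a : ℝ) * g * (1 - z)) + k₁ = p + k₁ := by rw [hp, hPr]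
    rw [hd₂', hp', ← ht, ← hW₂, ← hW₁, ← h1γd] at hL
    have hnum : y * y * d₂ + (1 - y) * W₂ = γ * d₂ := hγd.symm
    rw [hnum] at hL
    -- divide by `(p + k₁) d₂ (1 − γ)`
    have key : usage y t j k₁ (k₁ + a) * X * ((p + k₁) * ((1 - γ) * d₂))
        ≤ y * (B - usage y t j k₂ (k₁ + a) * C) * ((p + k₁) * ((1 - γ) * d₂)) := by
      have e1 : usage y t j k₁ (k₁ + a) * X * ((p + k₁) * ((1 - γ) * d₂)) = W₁ * X * ((1 - γ) * d₂) := by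
        rw [← hU₁W]; ring
      have e2 : y * (B - usage y t j k₂ (k₁ + a) * C) * ((p + k₁) * ((1 - γ) * d₂))
          = y * (p + k₁) * (B * ((1 - γ) * d₂) - γ * d₂ * C) := by
        rw [huK]
        have hγne : 1 - γ ≠ 0 := ne_of_gt (by linarith)
        field_simp
      rw [e1, e2]; rw [hB, hC]; exact hL
    exact le_of_mul_le_mul_right key (mul_pos hpK (mul_pos (by linarith) hd₂0))

set_option maxHeartbeats 800000 in
/-- **CELL QK ⟹ `Q` IS DEC** (the whole case tree).  See the file header. [this work] -/
theorem mixLawQ_decAtT_cellQK (y z g S lam : ℝ) (a j M k₁ k₂ : ℕ)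
    (hy0 : 0 < y) (hy1 : y < 1) (hz0 : 0 ≤ z) (hz1 : z < 1) (hg1 : g ≤ 1) (hyg : y ≤ (1 - z) * g) (ha : 1 ≤ a)
    (hta : y * (M : ℝ) ≤ S) (hk : k₁ ≤ k₂) (hk₂M : k₂ ≤ M) (hlam0 : 0 ≤ lam) (hlam1 : lam ≤ 1)
    (hmean : (1 - z) * ((k₁ : ℝ) + ((k₂ : ℝ) - k₁) * lam) = S)
    (hk₁j : k₁ ≤ j) (hk₁low : 2 * (k₁ : ℝ) < S + (a : ℝ) * g * (1 - z))
    (hPj : k₁ + a ≤ j) (hPmid : S + (a : ℝ) * g * (1 - z) ≤ 2 * ((k₁ + a : ℕ) : ℝ))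
    (hKj : k₂ ≤ j) (hKlow : 2 * (k₂ : ℝ) < S + (a : ℝ) * g * (1 - z)) (hG : j + 1 ≤ k₂ + a) :
    DECAtT y (S + (a : ℝ) * g * (1 - z)) j (M + a)
      (fun p => z * (if p = 0 then (1 : ℝ) else 0) + (1 - z) * slice (fun q => TP[k₁, k₂, lam, q]) a g p) := by
  by_cases hsat : (1 - z) * (1 - lam) * g ≤ usage y (S + (a : ℝ) * g * (1 - z)) j k₂ (k₁ + a) * ((1 - z) * lam * (1 - g))
  · exact mixLawQ_decAtT_qk_topSat y z g S lam a j M k₁ k₂ hy0 hy1 hz0 hz1 hg1 hyg ha hta hk hk₂M hlam0 hlam1 hmean hk₁j hk₁low hPj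
      hPmid hKj hKlow hG hsat
  have hfit : usage y (S + (a : ℝ) * g * (1 - z)) j k₂ (k₁ + a) * ((1 - z) * lam * (1 - g)) ≤ (1 - z) * (1 - lam) * g :=
    (not_le.1 hsat).le
  by_cases hcase : k₁ = 0 ∨ (k₁ : ℝ) + a ≤ S + (a : ℝ) * g * (1 - z)
  · exact mixLawQ_decAtT_qk_topFits y z g S lam a j M k₁ k₂ hy0 hy1 hz0 hz1 hg1 hyg ha hta hk hk₂M hlam0 hlam1 hmean hk₁j hk₁low hPj
      hPmid hKj hKlow hG hfit hcase
  have hk₁ : 1 ≤ k₁ := Nat.one_le_iff_ne_zero.2 (fun h => hcase (Or.inl h))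
  have hPt : S + (a : ℝ) * g * (1 - z) < (k₁ : ℝ) + a := not_le.1 (fun h => hcase (Or.inr h))
  by_cases hheavyK : y * (((k₁ : ℝ) + a) - k₂) ≤ S + (a : ℝ) * g * (1 - z) - 2 * (k₂ : ℝ)
  · exact mixLawQ_decAtT_qk_twinHigh_heavyTop y z g S lam a j M k₁ k₂ hy0 hy1 hz0 hz1 hg1 hyg ha hta hk hk₂M hlam0 hlam1 hmean hk₁
      hk₁j hk₁low hPj hPmid hPt hKj hKlow hG hfit hheavyK
  by_cases hlightk : S + (a : ℝ) * g * (1 - z) - 2 * (k₁ : ℝ) < y * (a : ℝ)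
  · exact mixLawQ_decAtT_qk_twinHigh_lightBoth y z g S lam a j M k₁ k₂ hy0 hy1 hz0 hz1 hg1 hyg ha hta hk hk₂M hlam0 hlam1 hmean hk₁
      hk₁j hk₁low hPj hPmid hPt hKj hKlow hG hfit (not_le.1 hheavyK) hlightk
  exact mixLawQ_decAtT_qk_twinHigh_lightTop_heavyLow y z g S lam a j M k₁ k₂ hy0 hy1 hz0 hz1 hg1 hyg ha hta hk hk₂M hlam0 hlam1 hmean
    hk₁ hk₁j hk₁low hPj hPmid hPt hKj hKlow hG hfit (not_le.1 hheavyK) (not_lt.1 hlightk)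

/-- **CELL QK HOLDS** (typer g30's binder `MixLawCellQK`). [this work] -/
theorem mixLawCellQK_holds : MixLawCellQK := by
  intro y z g S lam a j M k₁ k₂ hy0 hy1 hz0 hz1 hg1 hyg ha hjM hS0 hta hSj hSM hk hk₂M hlam0 hlam1 hmean hKj hKlow
  by_cases htop : k₂ + a ≤ j
  · exact mixLawCellQ1_holds y z g S lam a j M k₁ k₂ hy0 hy1 hz0 hz1 hg1 hyg ha hjM hS0 hta hSj hSM hk hk₂M hlam0 hlam1 hmean htop
  by_cases hPgiant : j + 1 ≤ k₁ + a
  · exact mixLawQ_decAtT_of_twinGiant y z g S lam a j M k₁ k₂ hy0 hy1 hz0 hz1 hg1 hyg ha hjM hk hk₂M hlam0 hlam1 hPgiant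
  -- otherwise: the twin is a mid (`t < 2a ≤ 2(k₁+a)`), `k₁ ≤ k₂ ≤ j` is a low or zero, `k₂ + a` a giant
  have h1z : 0 < 1 - z := by linarith
  have hkr : (k₁ : ℝ) ≤ k₂ := by exact_mod_cast hk
  have hS : S ≤ (k₂ : ℝ) := by
    rw [← hmean]
    have hd0 : 0 ≤ (k₂ : ℝ) - k₁ := by linarith
    have h3 : ((k₂ : ℝ) - k₁) * lam ≤ (k₂ : ℝ) - k₁ := mul_le_of_le_one_right hd0 hlam1
    have h0 : 0 ≤ (k₁ : ℝ) + ((k₂ : ℝ) - k₁) * lam := by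
      have : (0 : ℝ) ≤ k₁ := Nat.cast_nonneg k₁
      nlinarith [mul_nonneg hd0 hlam0]
    calc (1 - z) * ((k₁ : ℝ) + ((k₂ : ℝ) - k₁) * lam) ≤ 1 * ((k₁ : ℝ) + ((k₂ : ℝ) - k₁) * lam) :=
          mul_le_mul_of_nonneg_right (by linarith) h0
      _ ≤ k₂ := by linarith
  have hg0 : 0 < g := by
    by_contra hc
    have : (1 - z) * g ≤ 0 := mul_nonpos_of_nonneg_of_nonpos (by linarith) (not_lt.1 hc)
    linarith
  have hagz : (a : ℝ) * g * (1 - z) ≤ a := by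
    have h5 : g * (1 - z) ≤ 1 := by
      calc g * (1 - z) ≤ g * 1 := mul_le_mul_of_nonneg_left (by linarith) hg0.le
        _ ≤ 1 := by linarith
    have h6 := mul_le_mul_of_nonneg_left h5 (Nat.cast_nonneg a)
    linarith [h6, show (a : ℝ) * g * (1 - z) = (a : ℝ) * (g * (1 - z)) by ring]
  have hPmid : S + (a : ℝ) * g * (1 - z) ≤ 2 * ((k₁ + a : ℕ) : ℝ) := by
    have : (0 : ℝ) ≤ k₁ := Nat.cast_nonneg k₁
    push_cast; linarith
  exact mixLawQ_decAtT_cellQK y z g S lam a j M k₁ k₂ hy0 hy1 hz0 hz1 hg1 hyg ha hta hk hk₂M hlam0 hlam1 hmean (by omega)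
    (by linarith) (by omega) hPmid hKj hKlow (by omega)

end LawDec

end Quant

end Summit.CriticalPhenomena.PercolationContinuityZ3.Theorems
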